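import Summits.KontsevichZagierPeriods.KontsevichZagierPeriods.Theorems.FermatIsogenyFermatSectorCompleteBridges
import Summits.KontsevichZagierPeriods.KontsevichZagierPeriods.Theorems.FermatIsogenyFermatSectorCompleteInvariants
import Summits.KontsevichZagierPeriods.KontsevichZagierPeriods.Theorems.GammaHodgeSector.Negative.LoadBearing
import Literature.NumberTheory.Transcendental.KZProduct
import Literature.NumberTheory.Transcendental.KZProductIdeal
import Literature.NumberTheory.Transcendental.KZCalculusProofs

/-!
# `FermatSectorComplete` (stmt-KontsevichZagierPeriods-14252) — strategist census companion (unit `cstrat-…-14252-s1`)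

Sorry-free, kernel-checked companion of `Cruxes/FermatSectorComplete/STRATEGY-CENSUS.md`
(crux-strategist s1, 2026-08-17). The crux is `ker eval ≤ betaSector`,
`betaSector := relations ⊔ closure (S_lin ∪ S_prod)` (`FermatSectorCompleteKernelForm.fermatSectorComplete_iff_ker_le`,
p143622). This file records, kernel-checked, the reshaping attempts of the census that are NOT of the
absorbed shape "lever `T ≤ betaSector` + residual" (`…KernelForm.fermatSectorComplete_iff_residual`):

* §1 **π-localisation split modulo β** (`fermatSectorComplete_iff_piSplit`): the β-relative transfer of
  the sibling crux's split (`Cruxes/CompleteModGammaSector/StrategyCensus.lean` §1, stmt-14233) and of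
  route AyoubSpecialisation's `AyoubPiLocalKernel ∧ AyoubPiCancellation` (stmt-0540/0541). Genuine
  (neither conjunct absorbed, neither formally the crux) — and toolbox-empty: `PiLocalKernelModBeta`
  keeps the whole transcendence content (census §Decomposition / §Transfer).
* §2 **The dimension filtration collapses** (`fermatSectorComplete_iff_dimGe`): for every `d` the crux
  equals its restriction to pairs of dimension `≥ d` (slabs); no cut by dimension isolates a piece.
* §3 **The by-name split is exact modulo the route's own sector cruxes** (answer to the caution in
  `EQUIVALENCE-AUDIT.md` §4): `CompleteModGammaSector ∧ GammaHodgeSector` (stmt-14233 ∧ stmt-3742,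
  the two stubs of the registered skeleton v5) implies the crux (landed bridge, p144355) and the exact
  residual pair of skeleton v4 (`exact_of_byName`); and GIVEN `BetaLinearSector ∧ BetaProductSector`
  (cruxes 3–4 of the route, both consequences of the summit) the crux, the summit, the by-name pair and
  the exact pair are all EQUIVALENT (`crux_iff_byName_of_sectors`, `exact_iff_byName_of_sectors`,
  `byName_iff_summit`). So the a-priori extra strength of the by-name pair over the crux lives only
  in models where crux 4 fails — where the summit fails too (`betaProductSector_of_summit`,
  `summit_false_of_crux_not_byName`).
* §4 **Strengthenings typed**: the spectator-stable (ideal) form `SpectatorStableBeta` is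
  crux-implied (`spectatorStableBeta_of_crux`), i.e. a transcendence-free seam, not a strengthening
  with an induction variable (the analogue of the sibling's seam 3).
* §5 re-exports the negation interface (p144357).

References: Kontsevich–Zagier 2001 §1.2, §4.1; Ayoub, EMS Newsl. 91 (2014) Conj. 7; Huber–Wüstholz 2022
App. A.4; Cresson–Viu-Sos 2022 §1; Deligne 1982 Thm 7.18 (Koblitz–Ogus appendix); Wolfart–Wüstholz 1985.
-/

noncomputable section

-- `Summit.KontsevichZagierPeriods.KontsevichZagierPeriods.…` is the tree's mandated layout (single-conjunct summit).
set_option linter.dupNamespace false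

namespace Summit.KontsevichZagierPeriods.KontsevichZagierPeriods.Cruxes.FermatSectorComplete.StrategyCensus

open MeasureTheory Set
open scoped BigOperators
open Literature.NumberTheory.Transcendental
open Literature.NumberTheory.Transcendental.KZ
open Summit.KontsevichZagierPeriods.KontsevichZagierPeriods.Theses.FermatIsogeny
  (FermatSectorComplete BetaLinearSector BetaProductSector closes)
open Summit.KontsevichZagierPeriods.KontsevichZagierPeriods.Theses.TerasomaMultiplication
  (CompleteModGammaSector GammaHodgeSector)
open Summit.KontsevichZagierPeriods.FermatIsogeny.FermatSectorCompleteKernelForm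
  (fermatSectorComplete_iff_ker_le betaSector_le_ker_eval of_summit iff_summit_of_sectors
    fermatSectorComplete_iff_withoutRational)
open Summit.KontsevichZagierPeriods.FermatIsogeny.FermatSectorCompleteBridges
  (fermatSectorComplete_of_completeModGammaSector_of_gammaHodgeSector
    volumeCompleteModGammaBeta_of_completeModGammaSector longPairsModBeta_of_gammaHodgeSector
    fermatSectorComplete_iff_volumeBeta_and_longPairs)

/-! ## §0 The β-sector subgroup, named (the route file inlines it) -/

/-- `betaSector := relations ⊔ closure (S_lin ∪ S_prod)` — verbatim the subgroup of the crux
`FermatSectorComplete` (route FermatIsogeny rev 14). [cite: KontsevichZagier2001, §1.2 Conjecture 1] -/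
def betaSector : AddSubgroup FormalRep :=
  Literature.NumberTheory.Transcendental.KZ.relations ⊔ AddSubgroup.closure ({z : Literature.NumberTheory.Transcendental.KZ.FormalRep | ∃ (a b a' b' : ℚ) (c : ℝ) (ρ ρ' : Literature.NumberTheory.Transcendental.KZ.IntegralRep 1), 0 < a ∧ 0 < b ∧ 0 < a' ∧ 0 < b' ∧ IsAlgebraic ℚ c ∧ ρ.domain = {x | x 0 ∈ Set.Ioo (0:ℝ) 1} ∧ Set.EqOn ρ.integrand (fun x => (x 0) ^ ((a:ℝ) - 1) * (1 - x 0) ^ ((b:ℝ) - 1)) ρ.domain ∧ ρ'.domain = {x | x 0 ∈ Set.Ioo (0:ℝ) 1} ∧ Set.EqOn ρ'.integrand (fun x => c * (x 0) ^ ((a':ℝ) - 1) * (1 - x 0) ^ ((b':ℝ) - 1)) ρ'.domain ∧ ρ.value = ρ'.value ∧ z = Literature.NumberTheory.Transcendental.KZ.of ρ - Literature.NumberTheory.Transcendental.KZ.of ρ'} ∪ {z : Literature.NumberTheory.Transcendental.KZ.FormalRep | ∃ (a b e d a' b' e' d' : ℚ) (q : ℝ) (ρ ρ' : Literature.NumberTheory.Transcendental.KZ.IntegralRep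 2), 0 < a ∧ 0 < b ∧ 0 < e ∧ 0 < d ∧ 0 < a' ∧ 0 < b' ∧ 0 < e' ∧ 0 < d' ∧ IsAlgebraic ℚ q ∧ ρ.domain = {x | ∀ i, x i ∈ Set.Ioo (0:ℝ) 1} ∧ Set.EqOn ρ.integrand (fun x => (x 0) ^ ((a:ℝ) - 1) * (1 - x 0) ^ ((b:ℝ) - 1) * (x 1) ^ ((e:ℝ) - 1) * (1 - x 1) ^ ((d:ℝ) - 1)) ρ.domain ∧ ρ'.domain = {x | ∀ i, x i ∈ Set.Ioo (0:ℝ) 1} ∧ Set.EqOn ρ'.integrand (fun x => q * (x 0) ^ ((a':ℝ) - 1) * (1 - x 0) ^ ((b':ℝ) - 1) * (x 1) ^ ((e':ℝ) - 1) * (1 - x 1) ^ ((d':ℝ) - 1)) ρ'.domain ∧ ρ.value = ρ'.value ∧ z = Literature.NumberTheory.Transcendental.KZ.of ρ - Literature.NumberTheory.Transcendental.KZ.of ρ'})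

/-- Kernel form of the crux over the named subgroup (transport of p143622). [folklore] -/
theorem crux_iff_ker_le : FermatSectorComplete ↔ eval.ker ≤ betaSector :=
  fermatSectorComplete_iff_ker_le

/-- Soundness of the enlarged calculus over the named subgroup. [folklore] -/
theorem betaSector_le_ker : betaSector ≤ eval.ker := betaSector_le_ker_eval

theorem relations_le_betaSector : relations ≤ betaSector := le_sup_left

/-- The crux for ALL representations (rational shape not load-bearing), over the named subgroup. [folklore] -/
theorem crux_iff_withoutRational :
    FermatSectorComplete ↔
      ∀ ⦃n m : ℕ⦄ (r : IntegralRep n) (r' : IntegralRep m), r.value = r'.value → of r - of r' ∈ betaSector :=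
  fermatSectorComplete_iff_withoutRational

/-! ## §1 The π-localisation split modulo β (TRANSFER of the sibling's split; DECOMPOSITION) -/

/-- Multiplication by the disc class `[π]`. [cite: KontsevichZagier2001, §4.1] -/
def piMul : FormalRep → FormalRep := fun c => of piRep * c

@[simp] theorem piMul_apply (c : FormalRep) : piMul c = of piRep * c := rfl

/-- **π-LOCAL KERNEL MODULO β**: every value-zero combination is carried into `betaSector` by some
power of `[π]`. The β-relative form of `KZ.PiLocalKernel` (AyoubSpecialisation) and of the sibling's
`PiLocalKernelModGamma`. [cite: Ayoub2014, Conj. 7] -/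
def PiLocalKernelModBeta : Prop :=
  ∀ c : FormalRep, eval c = 0 → ∃ N : ℕ, piMul^[N] c ∈ betaSector

/-- **π-CANCELLATION MODULO β**: `[π]` is a non-zero-divisor on `FormalRep ⧸ betaSector`.
Transcendence-free; its motivic shadow (injectivity of effective into all formal periods) is printed
as OPEN (Huber–Wüstholz 2022, App. A.4). [cite: HuberWustholz2022, App. A.4] -/
def PiCancellationModBeta : Prop :=
  ∀ c : FormalRep, of piRep * c ∈ betaSector → c ∈ betaSector

theorem mem_betaSector_of_iterate_piMul_mem (hcanc : PiCancellationModBeta) :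
    ∀ (N : ℕ) (c : FormalRep), piMul^[N] c ∈ betaSector → c ∈ betaSector
  | 0, _, h => h
  | N + 1, c, h => by
    rw [Function.iterate_succ_apply] at h
    exact hcanc c (mem_betaSector_of_iterate_piMul_mem hcanc N _ h)

/-- The glue of the π-split (peeling induction). [folklore] -/
theorem fermatSectorComplete_of_piSplit (hloc : PiLocalKernelModBeta)
    (hcanc : PiCancellationModBeta) : FermatSectorComplete := by
  rw [crux_iff_ker_le]
  intro c hc
  obtain ⟨N, hN⟩ := hloc c (AddMonoidHom.mem_ker.mp hc)
  exact mem_betaSector_of_iterate_piMul_mem hcanc N c hN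

theorem piLocalKernelModBeta_of_crux (h : FermatSectorComplete) : PiLocalKernelModBeta :=
  fun c (hc : eval c = 0) => ⟨0, (crux_iff_ker_le.mp h) (AddMonoidHom.mem_ker.mpr hc)⟩

theorem piCancellationModBeta_of_crux (h : FermatSectorComplete) : PiCancellationModBeta := by
  intro c hc
  have h0 : eval (of piRep * c) = 0 := AddMonoidHom.mem_ker.mp (betaSector_le_ker hc)
  rw [eval_piRep_mul] at h0
  have hc0 : eval c = 0 := (mul_eq_zero.mp h0).resolve_left Real.pi_ne_zero
  exact (crux_iff_ker_le.mp h) (AddMonoidHom.mem_ker.mpr hc0)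

/-- **`FermatSectorComplete ↔ PiLocalKernelModBeta ∧ PiCancellationModBeta`.** [folklore] -/
theorem fermatSectorComplete_iff_piSplit :
    FermatSectorComplete ↔ PiLocalKernelModBeta ∧ PiCancellationModBeta :=
  ⟨fun h => ⟨piLocalKernelModBeta_of_crux h, piCancellationModBeta_of_crux h⟩,
    fun h => fermatSectorComplete_of_piSplit h.1 h.2⟩

/-! ## §2 The dimension filtration collapses (DECOMPOSITION by dimension) -/

/-- The crux restricted to pairs both of dimension `≥ d`. [folklore] -/
def DimGe (d : ℕ) : Prop :=
  ∀ ⦃n m : ℕ⦄ (r : IntegralRep n) (r' : IntegralRep m), d ≤ n → d ≤ m →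
    r.value = r'.value → of r - of r' ∈ betaSector

theorem dimGe_of_crux (d : ℕ) (h : FermatSectorComplete) : DimGe d :=
  fun _ _ r r' _ _ hv => (crux_iff_withoutRational.mp h) r r' hv

/-- **Collapse**: raise both representations by slabs (`KZ.IntegralRep.exists_equivalent_of_le`),
apply the truncated statement, come back through `relations ≤ betaSector`. [folklore] -/
theorem fermatSectorComplete_of_dimGe (d : ℕ) (h : DimGe d) : FermatSectorComplete := by
  rw [crux_iff_withoutRational]
  intro n m r r' hv
  obtain ⟨R, hR⟩ := r.exists_equivalent_of_le (Nat.le_add_right n d)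
  obtain ⟨R', hR'⟩ := r'.exists_equivalent_of_le (Nat.le_add_right m d)
  have hvR : R.value = R'.value := by
    rw [← Equivalent.value_eq_holds hR, ← Equivalent.value_eq_holds hR', hv]
  have hRR' : of R - of R' ∈ betaSector := h R R' (Nat.le_add_left d n) (Nat.le_add_left d m) hvR
  have h1 : of r - of R ∈ betaSector := relations_le_betaSector hR
  have h2 : of r' - of R' ∈ betaSector := relations_le_betaSector hR'
  have : of r - of r' = (of r - of R) + (of R - of R') - (of r' - of R') := by abel
  rw [this]
  exact betaSector.sub_mem (betaSector.add_mem h1 hRR') h2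

/-- **`FermatSectorComplete ↔ DimGe d` for every `d`.** [folklore] -/
theorem fermatSectorComplete_iff_dimGe (d : ℕ) : FermatSectorComplete ↔ DimGe d :=
  ⟨dimGe_of_crux d, fermatSectorComplete_of_dimGe d⟩

/-! ## §3 The by-name split (skeleton v5) against the exact residual split (skeleton v4) -/

/-- The by-name pair: the two stubs of the registered skeleton v5, items stmt-14233 and stmt-3742. -/
def ByName : Prop := CompleteModGammaSector ∧ GammaHodgeSector

/-- The exact residual pair of skeleton v4 (`VolumeCompleteModGammaBeta ∧ LongPairsModBeta`), verbatim
the right-hand side of `Bridges.fermatSectorComplete_iff_volumeBeta_and_longPairs` (p144355). -/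
def Exact : Prop :=
  (∀ H : AddSubgroup Literature.NumberTheory.Transcendental.KZ.FormalRep, Literature.NumberTheory.Transcendental.KZ.relations ≤ H → (∀ (N N' k : ℕ) (x y : Fin N → ℚ) (x' y' : Fin N' → ℚ) (c : ℝ), (∀ j, 0 < x j ∧ 0 < y j ∧ Int.fract (x j) ≠ 0 ∧ Int.fract (y j) ≠ 0) → (∀ l, 0 < x' l ∧ 0 < y' l ∧ Int.fract (x' l) ≠ 0 ∧ Int.fract (y' l) ≠ 0) → (∀ u : ℕ, 0 < u → (∀ j, Nat.Coprime u (x j).den ∧ Nat.Coprime u (y j).den) → (∀ l, Nat.Coprime u (x' l).den ∧ Nat.Coprime u (y' l).den) → ((∑ j, (Int.fract ((u : ℚ) * x j) + Int.fract ((u : ℚ) * y j) - Int.fract ((u : ℚ) * (x j + y j)))) - ∑ l, (Int.fract ((u : ℚ) * x' l) + Int.fract ((u : ℚ) * y' l) - Int.fract ((u : ℚ) * (x' l + y' l)))) = (k : ℚ)) → IsAlgebraic ℚ c → ∀ (ρ : Literature.NumberTheory.Transcendental.KZ.IntegralRep N) (ρ' : Literature.NumberTheory.Transcendental.KZ.IntegralRep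 (2 * k + N')), ρ.domain = {t | ∀ j, t j ∈ Set.Ioo (0:ℝ) 1} → Set.EqOn ρ.integrand (fun t => ∏ j, (t j) ^ ((x j : ℝ) - 1) * (1 - t j) ^ ((y j : ℝ) - 1)) ρ.domain → ρ'.domain = {z | (∑ i : Fin (2 * k), (z (Fin.castAdd N' i)) ^ 2) < 1 ∧ ∀ l : Fin N', z (Fin.natAdd (2 * k) l) ∈ Set.Ioo (0:ℝ) 1} → Set.EqOn ρ'.integrand (fun z => c * (k.factorial : ℝ) * ∏ l, (z (Fin.natAdd (2 * k) l)) ^ ((x' l : ℝ) - 1) * (1 - z (Fin.natAdd (2 * k) l)) ^ ((y' l : ℝ) - 1)) ρ'.domain → ρ.value = ρ'.value → Literature.NumberTheory.Transcendental.KZ.of ρ - Literature.NumberTheory.Transcendental.KZ.of ρ' ∈ H) → (∀ (a b a' b' : ℚ) (c : ℝ), 0 < a → 0 < b → 0 < a' → 0 < b' → IsAlgebraic ℚ c → ∀ (ρ ρ' : Literature.NumberTheory.Transcendental.KZ.IntegralRep 1), ρ.domain = {x | x 0 ∈ Set.Ioo (0:ℝ) 1} → Set.EqOn ρ.integrand (fun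 x => (x 0) ^ ((a:ℝ) - 1) * (1 - x 0) ^ ((b:ℝ) - 1)) ρ.domain → ρ'.domain = {x | x 0 ∈ Set.Ioo (0:ℝ) 1} → Set.EqOn ρ'.integrand (fun x => c * (x 0) ^ ((a':ℝ) - 1) * (1 - x 0) ^ ((b':ℝ) - 1)) ρ'.domain → ρ.value = ρ'.value → Literature.NumberTheory.Transcendental.KZ.of ρ - Literature.NumberTheory.Transcendental.KZ.of ρ' ∈ H) → (∀ (a b e d a' b' e' d' : ℚ) (q : ℝ), 0 < a → 0 < b → 0 < e → 0 < d → 0 < a' → 0 < b' → 0 < e' → 0 < d' → IsAlgebraic ℚ q → ∀ (ρ ρ' : Literature.NumberTheory.Transcendental.KZ.IntegralRep 2), ρ.domain = {x | ∀ i, x i ∈ Set.Ioo (0:ℝ) 1} → Set.EqOn ρ.integrand (fun x => (x 0) ^ ((a:ℝ) - 1) * (1 - x 0) ^ ((b:ℝ) - 1) * (x 1) ^ ((e:ℝ) - 1) * (1 - x 1) ^ ((d:ℝ) - 1)) ρ.domain → ρ'.domain = {x | ∀ i, x i ∈ Set.Ioo (0:ℝ) 1} → Set.EqOn ρ'.integrand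 (fun x => q * (x 0) ^ ((a':ℝ) - 1) * (1 - x 0) ^ ((b':ℝ) - 1) * (x 1) ^ ((e':ℝ) - 1) * (1 - x 1) ^ ((d':ℝ) - 1)) ρ'.domain → ρ.value = ρ'.value → Literature.NumberTheory.Transcendental.KZ.of ρ - Literature.NumberTheory.Transcendental.KZ.of ρ' ∈ H) → ∀ (d : ℕ) (K K' : Literature.NumberTheory.Transcendental.KZ.IntegralRep d), IsCompact K.domain → (interior K.domain).Nonempty → IsCompact K'.domain → (interior K'.domain).Nonempty → (∀ x ∈ K.domain, K.integrand x = 1) → (∀ x ∈ K'.domain, K'.integrand x = 1) → K.value = K'.value → Literature.NumberTheory.Transcendental.KZ.of K - Literature.NumberTheory.Transcendental.KZ.of K' ∈ H) ∧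
  (∀ (N N' k : ℕ) (x y : Fin N → ℚ) (x' y' : Fin N' → ℚ) (c : ℝ), ¬ (N ≤ 2 ∧ k + N' ≤ 2) → (∀ j, 0 < x j ∧ 0 < y j ∧ Int.fract (x j) ≠ 0 ∧ Int.fract (y j) ≠ 0) → (∀ l, 0 < x' l ∧ 0 < y' l ∧ Int.fract (x' l) ≠ 0 ∧ Int.fract (y' l) ≠ 0) → (∀ u : ℕ, 0 < u → (∀ j, Nat.Coprime u (x j).den ∧ Nat.Coprime u (y j).den) → (∀ l, Nat.Coprime u (x' l).den ∧ Nat.Coprime u (y' l).den) → ((∑ j, (Int.fract ((u : ℚ) * x j) + Int.fract ((u : ℚ) * y j) - Int.fract ((u : ℚ) * (x j + y j)))) - ∑ l, (Int.fract ((u : ℚ) * x' l) + Int.fract ((u : ℚ) * y' l) - Int.fract ((u : ℚ) * (x' l + y' l)))) = (k : ℚ)) → IsAlgebraic ℚ c → ∀ (ρ : Literature.NumberTheory.Transcendental.KZ.IntegralRep N) (ρ' : Literature.NumberTheory.Transcendental.KZ.IntegralRep (2 * k + N')), ρ.domain = {t | ∀ j, t j ∈ Set.Ioo (0:ℝ)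 1} → Set.EqOn ρ.integrand (fun t => ∏ j, (t j) ^ ((x j : ℝ) - 1) * (1 - t j) ^ ((y j : ℝ) - 1)) ρ.domain → ρ'.domain = {z | (∑ i : Fin (2 * k), (z (Fin.castAdd N' i)) ^ 2) < 1 ∧ ∀ l : Fin N', z (Fin.natAdd (2 * k) l) ∈ Set.Ioo (0:ℝ) 1} → Set.EqOn ρ'.integrand (fun z => c * (k.factorial : ℝ) * ∏ l, (z (Fin.natAdd (2 * k) l)) ^ ((x' l : ℝ) - 1) * (1 - z (Fin.natAdd (2 * k) l)) ^ ((y' l : ℝ) - 1)) ρ'.domain → ρ.value = ρ'.value → Literature.NumberTheory.Transcendental.KZ.of ρ - Literature.NumberTheory.Transcendental.KZ.of ρ' ∈ Literature.NumberTheory.Transcendental.KZ.relations ⊔ AddSubgroup.closure ({z : Literature.NumberTheory.Transcendental.KZ.FormalRep | ∃ (a b a' b' : ℚ) (c : ℝ) (ρ ρ' : Literature.NumberTheory.Transcendental.KZ.IntegralRep 1), 0 < a ∧ 0 < b ∧ 0 < a' ∧ 0 < b' ∧ IsAlgebraic ℚ c ∧ ρ.domain = {x | x 0 ∈ Set.Ioo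 (0:ℝ) 1} ∧ Set.EqOn ρ.integrand (fun x => (x 0) ^ ((a:ℝ) - 1) * (1 - x 0) ^ ((b:ℝ) - 1)) ρ.domain ∧ ρ'.domain = {x | x 0 ∈ Set.Ioo (0:ℝ) 1} ∧ Set.EqOn ρ'.integrand (fun x => c * (x 0) ^ ((a':ℝ) - 1) * (1 - x 0) ^ ((b':ℝ) - 1)) ρ'.domain ∧ ρ.value = ρ'.value ∧ z = Literature.NumberTheory.Transcendental.KZ.of ρ - Literature.NumberTheory.Transcendental.KZ.of ρ'} ∪ {z : Literature.NumberTheory.Transcendental.KZ.FormalRep | ∃ (a b e d a' b' e' d' : ℚ) (q : ℝ) (ρ ρ' : Literature.NumberTheory.Transcendental.KZ.IntegralRep 2), 0 < a ∧ 0 < b ∧ 0 < e ∧ 0 < d ∧ 0 < a' ∧ 0 < b' ∧ 0 < e' ∧ 0 < d' ∧ IsAlgebraic ℚ q ∧ ρ.domain = {x | ∀ i, x i ∈ Set.Ioo (0:ℝ) 1} ∧ Set.EqOn ρ.integrand (fun x => (x 0) ^ ((a:ℝ) - 1) * (1 - x 0) ^ ((b:ℝ) - 1) * (x 1) ^ ((e:ℝ)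 - 1) * (1 - x 1) ^ ((d:ℝ) - 1)) ρ.domain ∧ ρ'.domain = {x | ∀ i, x i ∈ Set.Ioo (0:ℝ) 1} ∧ Set.EqOn ρ'.integrand (fun x => q * (x 0) ^ ((a':ℝ) - 1) * (1 - x 0) ^ ((b':ℝ) - 1) * (x 1) ^ ((e':ℝ) - 1) * (1 - x 1) ^ ((d':ℝ) - 1)) ρ'.domain ∧ ρ.value = ρ'.value ∧ z = Literature.NumberTheory.Transcendental.KZ.of ρ - Literature.NumberTheory.Transcendental.KZ.of ρ'}))

/-- The exact pair IS the crux (p144355, re-exported over the names). [folklore] -/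
theorem crux_iff_exact : FermatSectorComplete ↔ Exact :=
  fermatSectorComplete_iff_volumeBeta_and_longPairs

/-- **By-name ⟹ crux** — the landed bridge (p144355); the glue of the filed split. [folklore] -/
theorem crux_of_byName (h : ByName) : FermatSectorComplete :=
  fermatSectorComplete_of_completeModGammaSector_of_gammaHodgeSector h.1 h.2

/-- **By-name ⟹ exact** (unconditionally): stub 1 (v4) ⟸ stmt-14233, stub 2l ⟸ stmt-3742. [folklore] -/
theorem exact_of_byName (h : ByName) : Exact :=
  ⟨volumeCompleteModGammaBeta_of_completeModGammaSector h.1, longPairsModBeta_of_gammaHodgeSector h.2⟩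

/-- **By-name ⟹ summit** (route TerasomaMultiplication's deciding theorem): the by-name pair is a
priori STRONGER than the crux — the content of the caution in `EQUIVALENCE-AUDIT.md` §4. [folklore] -/
theorem summit_of_byName (h : ByName) : KontsevichZagierPeriods :=
  Summit.KontsevichZagierPeriods.KontsevichZagierPeriods.Theses.TerasomaMultiplication.closes h.2 h.1

/-- **Summit ⟹ by-name**: both children are consequences of Conjecture 1. [folklore] -/
theorem byName_of_summit (h : KontsevichZagierPeriods) : ByName :=
  ⟨Summit.KontsevichZagierPeriods.CompleteModGammaSectorNegative.of_summit h,
    Summit.KontsevichZagierPeriods.GammaHodgeSectorNegative.of_summit h⟩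

/-- The by-name pair is EQUIVALENT to the summit. [folklore] -/
theorem byName_iff_summit : ByName ↔ KontsevichZagierPeriods :=
  ⟨summit_of_byName, byName_of_summit⟩

/-- **Modulo the route's own sector cruxes 3–4, the by-name pair IS the crux.** [folklore] -/
theorem crux_iff_byName_of_sectors (h₃ : BetaLinearSector) (h₄ : BetaProductSector) :
    FermatSectorComplete ↔ ByName :=
  ⟨fun h₅ => byName_of_summit ((iff_summit_of_sectors h₃ h₄).mp h₅), crux_of_byName⟩

/-- **Modulo cruxes 3–4 the by-name split and the exact residual split coincide.** [folklore] -/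
theorem exact_iff_byName_of_sectors (h₃ : BetaLinearSector) (h₄ : BetaProductSector) :
    Exact ↔ ByName :=
  crux_iff_exact.symm.trans (crux_iff_byName_of_sectors h₃ h₄)

/-- Crux 4 alone already suffices for the collapse (crux 3 ⟸ crux 4, p143559). [folklore] -/
theorem crux_iff_byName_of_betaProductSector (h₄ : BetaProductSector) :
    FermatSectorComplete ↔ ByName :=
  crux_iff_byName_of_sectors
    (Summit.KontsevichZagierPeriods.FermatIsogeny.BetaLinearOfProduct.betaLinearSector_of_betaProductSector h₄) h₄

/-- Crux 4 is itself a consequence of the summit: the only models separating the by-name pair from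
the crux are models of `¬ KontsevichZagierPeriods`. [folklore] -/
theorem betaProductSector_of_summit (h : KontsevichZagierPeriods) : BetaProductSector := by
  intro a b e d a' b' e' d' q _ _ _ _ _ _ _ _ _ ρ ρ' _ _ _ _ hv
  exact Summit.KontsevichZagierPeriods.GammaHodgeSectorNegative.core_of_summit h ρ ρ' hv

/-- Hence: wherever the crux holds but the by-name pair fails, the summit is false. [folklore] -/
theorem summit_false_of_crux_not_byName (h₅ : FermatSectorComplete) (hn : ¬ ByName) :
    ¬ KontsevichZagierPeriods :=
  fun hs => hn ((crux_iff_byName_of_betaProductSector (betaProductSector_of_summit hs)).mp h₅)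

/-! ## §4 Strengthenings typed: the spectator-stable / ideal form is crux-implied -/

/-- **Spectator stability of the β-sector**: multiplying an element of `betaSector` by the class of any
representation stays in `betaSector` (the β-sector is a left ideal for the product of `KZ.FormalRep`).
NOT provable from the β-axioms (`closure S` is a subgroup, not an ideal: lead c8 worker B), but
crux-implied — a transcendence-free SEAM of the crux, not a strengthening with teeth. [folklore] -/
def SpectatorStableBeta : Prop :=
  ∀ {n : ℕ} (s : IntegralRep n) (c : FormalRep), c ∈ betaSector → of s * c ∈ betaSector

theorem spectatorStableBeta_of_crux (h : FermatSectorComplete) : SpectatorStableBeta := by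
  intro n s c hc
  have hc0 : eval c = 0 := AddMonoidHom.mem_ker.mp (betaSector_le_ker hc)
  have h0 : eval (of s * c) = 0 := by
    rw [eval_mul prodFunSemialgebraic_holds, hc0, mul_zero]
  exact (crux_iff_ker_le.mp h) (AddMonoidHom.mem_ker.mpr h0)

/-! ## §5 Negation interface (p144357): the only shape of a refutation -/

/-- A separating additive invariant killing relations and every TRUE β-pair refutes the crux
(re-export of `FermatSectorCompleteInvariants.not_fermatSectorComplete_of_separating_invariant`);
checking that an invariant kills every true β-product pair presupposes knowing which β-product
identities are true (Rohrlich–Lang, open since 1978) — census §Negation. [folklore] -/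
example := @Summit.KontsevichZagierPeriods.FermatIsogeny.FermatSectorCompleteInvariants.not_fermatSectorComplete_of_separating_invariant

end Summit.KontsevichZagierPeriods.KontsevichZagierPeriods.Cruxes.FermatSectorComplete.StrategyCensus

end
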